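import Summits.MatrixMultiplication.MatrixMultiplication.Theorems.SoloBlindDegenerationRealization
import HarnessLib

/-!
# Group degenerations to `T_{cw,2}^{⊠N}` in the Coppersmith–Winograd basis need `|H| ≥ 4^N`

Work in the Coppersmith–Winograd basis, where `T_{cw,2} = ∑_{i=1,2} (x₀yᵢzᵢ + xᵢy₀zᵢ + xᵢyᵢz₀)` has the
one-coordinate support `cwAt` below and `T_{cw,2}^{⊠N}` the coordinatewise support (this is the inline
form of `kroneckerPow (cwTensor ℂ 2) N`, cf. `cwTwoPow_inline_eq`).  The cheapest conceivable
certificates for an upper bound on the border rank of `T_{cw,2}^{⊠N}` — and hence on the asymptotic rank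
of `T_{cw,2}`, whose value `3` would give `ω = 2` (Coppersmith–Winograd 1990, §11) — are **group
degenerations**: maps `α β γ : (Fin N → Fin 3) → H` into a finite abelian group and leg weights
`ω₁ ω₂ ω₃` with an order `h` such that every support triple satisfies `α a + β b + γ c = u` with weight
exactly `h`, and every other solution of `α a + β b + γ c = u` has weight `> h`.  Such data exhibit
`T_{cw,2}^{⊠N}` as a monomial degeneration of a restriction of the structure tensor of `ℂ[H]`, so
`bR(T_{cw,2}^{⊠N}) ≤ |H|` (Bürgisser–Clausen–Shokrollahi §15.4; Alman–Vassilevska Williams, ITCS 2018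
§3.2 and FOCS 2018 §7, where `CW_q ⊴ T_{ℤ/(q+2)}` is obtained this way).  With `H = (ℤ/4)^N` they exist,
even with all weights zero (`cwRealization_zmod4_pow`).

**Theorem** (`four_pow_le_card_of_cwDegeneration`).  Any such data have `4 ^ N ≤ |H|`.  In particular
(`four_pow_le_card_of_cwRealization`) an exact realization `α a + β b + γ c = u ↔ support` needs
`|H| ≥ 4^N`.  So within this class the bound `bR(T_{cw,2}^{⊠N}) ≤ 4^N = bR(T_{cw,2})^N` can never be
improved, for any `N` and any finite abelian group: lowering the asymptotic rank of `T_{cw,2}` below `4`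
needs certificates that are not group degenerations in the CW basis.

Proof.  With `z_L = (0 on L, 1 off L)`, `t_M = (2 on M, 1 off M)` (`L, M ⊆ [N]`) the map
`Ψ(L, M) = α z_L + β t_M` is injective on the `4^N` pairs.  Tools: shift rules
`α z_{L⊔P} = α z_L + R(P)`, `β t_{M⊔Q} = β t_M + S(Q)`, `α t_{M⊔Q} = α t_M + S(Q)` (`S(Q) = γ 1_Q - γ 2_Q`,
so `2 S(Q) = 0`), each read off from two support triples, and the *exchange lemma*: two solutions of
`α a + β b + γ c = u` with the same leg multiset as two support triples have total weight `2h`, so one of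
them is a support triple.  `Ψ(L,M) = Ψ(L',M')` is padded to `Ψ(L⊔P, A₂) = Ψ(L'⊔P, S₂)` with
`A₂ ⊆ L⊔P`, `S₂ ⊆ L'⊔P`, `P = (M ∆ M') ∖ (L ∪ L')`; exchanging the third legs of `(z_{L⊔P}, t_{A₂}, k)` and
`(z_{L'⊔P}, t_{S₂}, k')` forces `L = L'`, and then exchanging `(t_M, t_{M'}, 0), (t_{M'}, t_M, 0)` against
the diagonal triples forces `M = M'`. ∎

## References
* D. Coppersmith, S. Winograd, *Matrix multiplication via arithmetic progressions*, J. Symb. Comput. 9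
  (1990), §11 (asymptotic rank `3` of `T_{cw,2}` would give `ω = 2`).
* J. Alman, V. Vassilevska Williams, *Further limitations of the known approaches for matrix
  multiplication*, ITCS 2018, arXiv:1712.07246, §3.2 (`CW_q` as a monomial degeneration of `T_{q+2}`).
* J. Alman, V. Vassilevska Williams, *Limits on all known (and some unknown) approaches to matrix
  multiplication*, FOCS 2018, arXiv:1810.08671, §7 (`CW_q` is not a sub-tensor of `T_G`, `|G| = q+2`,
  `3 ≤ q ≤ 9`; `CW_q ⊴ T_{q+2}` for `q = 1, 2`).
* P. Bürgisser, M. Clausen, M. A. Shokrollahi, *Algebraic Complexity Theory*, Springer 1997, §15.4.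
-/

namespace Summit.MatrixMultiplication.MatrixMultiplication.Theorems

set_option linter.dupNamespace false

section CwBasis

variable {N : ℕ} {H : Type*} [AddCommGroup H]

/-- The support of `T_{cw,2}` in the Coppersmith–Winograd basis `x₀, x₁, x₂` (one coordinate),
`{(0,i,i), (i,0,i), (i,i,0) : i = 1, 2}`, as a Boolean test. -/
def cwAt (x y z : Fin 3) : Bool :=
  decide ((x = 0 ∧ y = z ∧ y ≠ 0) ∨ (y = 0 ∧ x = z ∧ x ≠ 0) ∨ (z = 0 ∧ x = y ∧ x ≠ 0))

/-- `cwAt` is the inline support predicate of `kroneckerPow (cwTensor ℂ 2) N` (one coordinate). -/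
theorem cwAt_iff (x y z : Fin 3) :
    cwAt x y z = true ↔
      (x = 0 ∧ y = z ∧ y ≠ 0) ∨ (y = 0 ∧ x = z ∧ x ≠ 0) ∨ (z = 0 ∧ x = y ∧ x ≠ 0) := by
  unfold cwAt; rw [decide_eq_true_iff]

/-! ### Legs indexed by subsets of the coordinates (as `Bool`-valued indicators) -/

/-- `z_L = (0 on L, 1 off L)`. -/
def zLeg (l : Fin N → Bool) : Fin N → Fin 3 := fun i => if l i then 0 else 1
/-- `t_M = (2 on M, 1 off M)`. -/
def tLeg (m : Fin N → Bool) : Fin N → Fin 3 := fun i => if m i then 2 else 1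
/-- `k_{L,M} = (t_M on L, 0 off L)`: the third leg of the support triple `(z_L, t_M, ·)` when `M ⊆ L`. -/
def kLeg (l m : Fin N → Bool) : Fin N → Fin 3 := fun i => if l i then (if m i then 2 else 1) else 0
/-- `1_Q`. -/
def oneLeg (q : Fin N → Bool) : Fin N → Fin 3 := fun i => if q i then 1 else 0
/-- `2_Q`. -/
def twoLeg (q : Fin N → Bool) : Fin N → Fin 3 := fun i => if q i then 2 else 0
/-- `(0 on Q, t_M off Q)`. -/
def xLeg (m q : Fin N → Bool) : Fin N → Fin 3 := fun i => if q i then 0 else if m i then 2 else 1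

/-! ### One-coordinate facts (closed Boolean computations) -/

/-- Support triple `(z_{L₁}, z_{L₂}, 1_{L₁⊔L₂})`, one coordinate. -/
theorem cwAt_E (b1 b2 b3 : Bool) (h3 : b3 = (b1 || b2)) (hd : (b1 && b2) = false) :
    cwAt (if b1 then 0 else 1) (if b2 then 0 else 1) (if b3 then 1 else 0) = true := by
  revert h3 hd; cases b1 <;> cases b2 <;> cases b3 <;> decide

/-- Support triple `(z_L, t_M, k_{L,M})` for `M ⊆ L`, one coordinate. -/
theorem cwAt_k (p q : Bool) (h : (q && !p) = false) :
    cwAt (if p then 0 else 1) (if q then 2 else 1) (if p then (if q then 2 else 1) else 0) = true := by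
  revert h; cases p <;> cases q <;> decide

/-- Support triple `(x_{M,Q}, t_M, 1_Q)`, one coordinate. -/
theorem cwAt_x1 (bm bq : Bool) (hd : (bm && bq) = false) :
    cwAt (if bq then 0 else if bm then 2 else 1) (if bm then 2 else 1) (if bq then 1 else 0) = true := by
  revert hd; cases bm <;> cases bq <;> decide

/-- Support triple `(x_{M,Q}, t_{M⊔Q}, 2_Q)`, one coordinate. -/
theorem cwAt_x2 (bm bq bmq : Bool) (h : bmq = (bm || bq)) (hd : (bm && bq) = false) :
    cwAt (if bq then 0 else if bm then 2 else 1) (if bmq then 2 else 1) (if bq then 2 else 0)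
      = true := by
  revert h hd; cases bm <;> cases bq <;> cases bmq <;> decide

/-- Support triple `(t_M, x_{M,Q}, 1_Q)`, one coordinate. -/
theorem cwAt_x1' (bm bq : Bool) (hd : (bm && bq) = false) :
    cwAt (if bm then 2 else 1) (if bq then 0 else if bm then 2 else 1) (if bq then 1 else 0) = true := by
  revert hd; cases bm <;> cases bq <;> decide

/-- Support triple `(t_{M⊔Q}, x_{M,Q}, 2_Q)`, one coordinate. -/
theorem cwAt_x2' (bm bq bmq : Bool) (h : bmq = (bm || bq)) (hd : (bm && bq) = false) :
    cwAt (if bmq then 2 else 1) (if bq then 0 else if bm then 2 else 1) (if bq then 2 else 0)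
      = true := by
  revert h hd; cases bm <;> cases bq <;> cases bmq <;> decide

/-- Diagonal support triple `(t_M, t_M, 0)`, one coordinate. -/
theorem cwAt_diag (bm : Bool) : cwAt (if bm then 2 else 1) (if bm then 2 else 1) 0 = true := by
  cases bm <;> decide

/-- A support triple of shape `(z_L, t_M, k_{L',M'})` has `L = L'` coordinatewise. -/
theorem eq_of_cwAt_swap (p1 q1 p2 q2 : Bool)
    (h : cwAt (if p1 then 0 else 1) (if q1 then 2 else 1) (if p2 then (if q2 then 2 else 1) else 0)
      = true) : p1 = p2 := by
  revert h; cases p1 <;> cases q1 <;> cases p2 <;> cases q2 <;> decide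

/-- A support triple `(t_M, t_M', 0)` has `M = M'` coordinatewise. -/
theorem eq_of_cwAt_diag (q1 q2 : Bool)
    (h : cwAt (if q1 then 2 else 1) (if q2 then 2 else 1) 0 = true) : q1 = q2 := by
  revert h; cases q1 <;> cases q2 <;> decide

/-! ### The degeneration data -/

variable (α β γ : (Fin N → Fin 3) → H) (u : H) (ω₁ ω₂ ω₃ : (Fin N → Fin 3) → ℕ) (h : ℕ)
  (hsupp : ∀ a b c : Fin N → Fin 3, (∀ i, cwAt (a i) (b i) (c i) = true) →
    α a + β b + γ c = u ∧ ω₁ a + ω₂ b + ω₃ c = h)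
  (hcut : ∀ a b c : Fin N → Fin 3, α a + β b + γ c = u → ¬ (∀ i, cwAt (a i) (b i) (c i) = true) →
    h < ω₁ a + ω₂ b + ω₃ c)

include hsupp in
/-- Shift rule for the first leg: `α z_{L ⊔ P} = α z_L + (β z_P - β z_∅)`. [new] -/
theorem alpha_zLeg_union (l p lp : Fin N → Bool) (hlp : ∀ i, lp i = (l i || p i))
    (hd : ∀ i, (l i && p i) = false) :
    α (zLeg lp) = α (zLeg l) + (β (zLeg p) - β (zLeg fun _ => false)) := by
  have e1 := (hsupp (zLeg lp) (zLeg fun _ => false) (oneLeg lp)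
    (fun i => cwAt_E (lp i) false (lp i) (by simp) (by simp))).1
  have e2 := (hsupp (zLeg l) (zLeg p) (oneLeg lp)
    (fun i => cwAt_E (l i) (p i) (lp i) (hlp i) (hd i))).1
  calc α (zLeg lp)
      = α (zLeg lp) + (α (zLeg l) + β (zLeg p) + γ (oneLeg lp))
          - (α (zLeg lp) + β (zLeg fun _ => false) + γ (oneLeg lp)) := by rw [e1, e2]; abel
    _ = α (zLeg l) + (β (zLeg p) - β (zLeg fun _ => false)) := by abel

include hsupp in
/-- Shift rule for the second leg: `β t_{M ⊔ Q} = β t_M + S(Q)`, `S(Q) = γ 1_Q - γ 2_Q`. [new] -/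
theorem beta_tLeg_union (m q mq : Fin N → Bool) (hmq : ∀ i, mq i = (m i || q i))
    (hd : ∀ i, (m i && q i) = false) :
    β (tLeg mq) = β (tLeg m) + (γ (oneLeg q) - γ (twoLeg q)) := by
  have e1 := (hsupp (xLeg m q) (tLeg m) (oneLeg q) (fun i => cwAt_x1 (m i) (q i) (hd i))).1
  have e2 := (hsupp (xLeg m q) (tLeg mq) (twoLeg q)
    (fun i => cwAt_x2 (m i) (q i) (mq i) (hmq i) (hd i))).1
  calc β (tLeg mq)
      = β (tLeg mq) + (α (xLeg m q) + β (tLeg m) + γ (oneLeg q))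
          - (α (xLeg m q) + β (tLeg mq) + γ (twoLeg q)) := by rw [e1, e2]; abel
    _ = β (tLeg m) + (γ (oneLeg q) - γ (twoLeg q)) := by abel

include hsupp in
/-- The same shift rule for the first leg on `t`-vectors: `α t_{M ⊔ Q} = α t_M + S(Q)`. [new] -/
theorem alpha_tLeg_union (m q mq : Fin N → Bool) (hmq : ∀ i, mq i = (m i || q i))
    (hd : ∀ i, (m i && q i) = false) :
    α (tLeg mq) = α (tLeg m) + (γ (oneLeg q) - γ (twoLeg q)) := by
  have e1 := (hsupp (tLeg m) (xLeg m q) (oneLeg q) (fun i => cwAt_x1' (m i) (q i) (hd i))).1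
  have e2 := (hsupp (tLeg mq) (xLeg m q) (twoLeg q)
    (fun i => cwAt_x2' (m i) (q i) (mq i) (hmq i) (hd i))).1
  calc α (tLeg mq)
      = α (tLeg mq) + (α (tLeg m) + β (xLeg m q) + γ (oneLeg q))
          - (α (tLeg mq) + β (xLeg m q) + γ (twoLeg q)) := by rw [e1, e2]; abel
    _ = α (tLeg m) + (γ (oneLeg q) - γ (twoLeg q)) := by abel

include hsupp in
/-- `S(Q) = γ 1_Q - γ 2_Q` is `2`-torsion. [new] -/
theorem S_add_S (q : Fin N → Bool) :
    (γ (oneLeg q) - γ (twoLeg q)) + (γ (oneLeg q) - γ (twoLeg q)) = 0 := by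
  have e3 := alpha_tLeg_union α β γ u ω₁ ω₂ ω₃ h hsupp (fun _ => false) q q (by simp) (by simp)
  have e4 := beta_tLeg_union α β γ u ω₁ ω₂ ω₃ h hsupp (fun _ => false) q q (by simp) (by simp)
  have d1 := (hsupp (tLeg q) (tLeg q) (fun _ => 0) (fun i => cwAt_diag (q i))).1
  have d0 := (hsupp (tLeg fun _ => false) (tLeg fun _ => false) (fun _ => 0)
    (fun _ => cwAt_diag false)).1
  calc (γ (oneLeg q) - γ (twoLeg q)) + (γ (oneLeg q) - γ (twoLeg q))
      = (α (tLeg q) + β (tLeg q) + γ (fun _ => 0))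
          - (α (tLeg fun _ => false) + β (tLeg fun _ => false) + γ (fun _ => 0)) := by
            rw [e3, e4]; abel
    _ = 0 := by rw [d1, d0]; abel

include hsupp in
/-- `S` is additive over disjoint unions. [new] -/
theorem S_union (x x' y : Fin N → Bool) (hy : ∀ i, y i = (x i || x' i))
    (hd : ∀ i, (x i && x' i) = false) :
    (γ (oneLeg y) - γ (twoLeg y))
      = (γ (oneLeg x) - γ (twoLeg x)) + (γ (oneLeg x') - γ (twoLeg x')) := by
  have e1 := beta_tLeg_union α β γ u ω₁ ω₂ ω₃ h hsupp x x' y hy hd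
  have e2 := beta_tLeg_union α β γ u ω₁ ω₂ ω₃ h hsupp (fun _ => false) x x (by simp) (by simp)
  have e3 := beta_tLeg_union α β γ u ω₁ ω₂ ω₃ h hsupp (fun _ => false) y y (by simp) (by simp)
  calc (γ (oneLeg y) - γ (twoLeg y))
      = β (tLeg y) - β (tLeg fun _ => false) := by rw [e3]; abel
    _ = _ := by rw [e1, e2]; abel

include hsupp hcut in
/-- **Exchange lemma.** Two solutions of `α a + β b + γ c = u` with the same leg multisets as two
support triples cannot both lie outside the support. [new] -/
theorem cwSupp_or_of_exchange (a₁ b₁ c₁ a₂ b₂ c₂ : Fin N → Fin 3)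
    (h₁ : ∀ i, cwAt (a₁ i) (b₁ i) (c₁ i) = true) (h₂ : ∀ i, cwAt (a₂ i) (b₂ i) (c₂ i) = true)
    (e₁ : α a₁ + β b₁ + γ c₂ = u) (e₂ : α a₂ + β b₂ + γ c₁ = u) :
    (∀ i, cwAt (a₁ i) (b₁ i) (c₂ i) = true) ∨ (∀ i, cwAt (a₂ i) (b₂ i) (c₁ i) = true) := by
  by_contra hne
  obtain ⟨hn1, hn2⟩ := not_or.mp hne
  have := (hsupp a₁ b₁ c₁ h₁).2; have := (hsupp a₂ b₂ c₂ h₂).2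
  have := hcut a₁ b₁ c₂ e₁ hn1; have := hcut a₂ b₂ c₁ e₂ hn2; omega

include hsupp hcut in
/-- Exchange lemma, second-leg version. [new] -/
theorem cwSupp_or_of_exchange₂ (a₁ b₁ c₁ a₂ b₂ c₂ : Fin N → Fin 3)
    (h₁ : ∀ i, cwAt (a₁ i) (b₁ i) (c₁ i) = true) (h₂ : ∀ i, cwAt (a₂ i) (b₂ i) (c₂ i) = true)
    (e₁ : α a₁ + β b₂ + γ c₁ = u) (e₂ : α a₂ + β b₁ + γ c₂ = u) :
    (∀ i, cwAt (a₁ i) (b₂ i) (c₁ i) = true) ∨ (∀ i, cwAt (a₂ i) (b₁ i) (c₂ i) = true) := by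
  by_contra hne
  obtain ⟨hn1, hn2⟩ := not_or.mp hne
  have := (hsupp a₁ b₁ c₁ h₁).2; have := (hsupp a₂ b₂ c₂ h₂).2
  have := hcut a₁ b₂ c₁ e₁ hn1; have := hcut a₂ b₁ c₂ e₂ hn2; omega

include hsupp hcut in
/-- **Key step**: `Ψ(L, M) = α z_L + β t_M` is injective. [new] -/
theorem zLeg_tLeg_injective (l m l' m' : Fin N → Bool)
    (e : α (zLeg l) + β (tLeg m) = α (zLeg l') + β (tLeg m')) : l = l' ∧ m = m' := by
  -- Step A : l = l'
  have hl : l = l' := by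
    -- d = M ∩ M', x = M ∖ M', x' = M' ∖ M, y = M ∆ M', p = y ∖ (L ∪ L'), ls = L ∪ p, ls' = L' ∪ p,
    -- a2 = y ∩ (L ∖ L'), s2 = y ∖ (L ∖ L')
    obtain ⟨d, hdd⟩ : ∃ d : Fin N → Bool, ∀ i, d i = (m i && m' i) := ⟨_, fun _ => rfl⟩
    obtain ⟨x, hx⟩ : ∃ x : Fin N → Bool, ∀ i, x i = (m i && !(m' i)) := ⟨_, fun _ => rfl⟩
    obtain ⟨x', hx'⟩ : ∃ x' : Fin N → Bool, ∀ i, x' i = (m' i && !(m i)) := ⟨_, fun _ => rfl⟩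
    obtain ⟨y, hy⟩ : ∃ y : Fin N → Bool, ∀ i, y i = (x i || x' i) := ⟨_, fun _ => rfl⟩
    obtain ⟨p, hp⟩ : ∃ p : Fin N → Bool, ∀ i, p i = (y i && !(l i) && !(l' i)) :=
      ⟨_, fun _ => rfl⟩
    obtain ⟨ls, hls⟩ : ∃ ls : Fin N → Bool, ∀ i, ls i = (l i || p i) := ⟨_, fun _ => rfl⟩
    obtain ⟨ls', hls'⟩ : ∃ ls' : Fin N → Bool, ∀ i, ls' i = (l' i || p i) := ⟨_, fun _ => rfl⟩
    obtain ⟨a2, ha2⟩ : ∃ a2 : Fin N → Bool, ∀ i, a2 i = (y i && (l i && !(l' i))) :=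
      ⟨_, fun _ => rfl⟩
    obtain ⟨s2, hs2⟩ : ∃ s2 : Fin N → Bool, ∀ i, s2 i = (y i && !(l i && !(l' i))) :=
      ⟨_, fun _ => rfl⟩
    have hm : β (tLeg m) = β (tLeg d) + (γ (oneLeg x) - γ (twoLeg x)) :=
      beta_tLeg_union α β γ u ω₁ ω₂ ω₃ h hsupp d x m
        (fun i => by rw [hdd i, hx i]; cases m i <;> cases m' i <;> rfl)
        (fun i => by rw [hdd i, hx i]; cases m i <;> cases m' i <;> rfl)
    have hm' : β (tLeg m') = β (tLeg d) + (γ (oneLeg x') - γ (twoLeg x')) :=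
      beta_tLeg_union α β γ u ω₁ ω₂ ω₃ h hsupp d x' m'
        (fun i => by rw [hdd i, hx' i]; cases m i <;> cases m' i <;> rfl)
        (fun i => by rw [hdd i, hx' i]; cases m i <;> cases m' i <;> rfl)
    have Sy : (γ (oneLeg y) - γ (twoLeg y))
        = (γ (oneLeg x) - γ (twoLeg x)) + (γ (oneLeg x') - γ (twoLeg x')) :=
      S_union α β γ u ω₁ ω₂ ω₃ h hsupp x x' y hy
        (fun i => by rw [hx i, hx' i]; cases m i <;> cases m' i <;> rfl)
    have Sy' : (γ (oneLeg y) - γ (twoLeg y))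
        = (γ (oneLeg a2) - γ (twoLeg a2)) + (γ (oneLeg s2) - γ (twoLeg s2)) :=
      S_union α β γ u ω₁ ω₂ ω₃ h hsupp a2 s2 y
        (fun i => by rw [ha2 i, hs2 i]; cases y i <;> cases l i <;> cases l' i <;> rfl)
        (fun i => by rw [ha2 i, hs2 i]; cases y i <;> cases l i <;> cases l' i <;> rfl)
    have two_x := S_add_S α β γ u ω₁ ω₂ ω₃ h hsupp x
    have two_s2 := S_add_S α β γ u ω₁ ω₂ ω₃ h hsupp s2
    have two_y := S_add_S α β γ u ω₁ ω₂ ω₃ h hsupp y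
    have hlp : ∀ i, (l i && p i) = false := fun i => by
      rw [hp i]; cases l i <;> cases y i <;> cases l' i <;> rfl
    have hlp' : ∀ i, (l' i && p i) = false := fun i => by
      rw [hp i]; cases l i <;> cases y i <;> cases l' i <;> rfl
    have hL := alpha_zLeg_union α β γ u ω₁ ω₂ ω₃ h hsupp l p ls hls hlp
    have hL' := alpha_zLeg_union α β γ u ω₁ ω₂ ω₃ h hsupp l' p ls' hls' hlp'
    have hA2 :=
      beta_tLeg_union α β γ u ω₁ ω₂ ω₃ h hsupp (fun _ => false) a2 a2 (by simp) (by simp)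
    have hS2 :=
      beta_tLeg_union α β γ u ω₁ ω₂ ω₃ h hsupp (fun _ => false) s2 s2 (by simp) (by simp)
    have key0 : (γ (oneLeg x') - γ (twoLeg x')) - (γ (oneLeg x) - γ (twoLeg x))
        + (γ (oneLeg a2) - γ (twoLeg a2)) - (γ (oneLeg s2) - γ (twoLeg s2)) = 0 := by
      calc _ = ((γ (oneLeg x) - γ (twoLeg x)) + (γ (oneLeg x') - γ (twoLeg x')))
            + ((γ (oneLeg a2) - γ (twoLeg a2)) + (γ (oneLeg s2) - γ (twoLeg s2)))
            - ((γ (oneLeg x) - γ (twoLeg x)) + (γ (oneLeg x) - γ (twoLeg x)))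
            - ((γ (oneLeg s2) - γ (twoLeg s2)) + (γ (oneLeg s2) - γ (twoLeg s2))) := by abel
        _ = 0 := by rw [← Sy, ← Sy', two_x, two_s2, two_y]; abel
    have EQ : α (zLeg ls) + β (tLeg a2) = α (zLeg ls') + β (tLeg s2) := by
      have e' : α (zLeg l) = α (zLeg l') + ((γ (oneLeg x') - γ (twoLeg x'))
          - (γ (oneLeg x) - γ (twoLeg x))) := by
        calc α (zLeg l) = (α (zLeg l) + β (tLeg m)) - β (tLeg m) := by abel
          _ = (α (zLeg l') + β (tLeg m')) - β (tLeg m) := by rw [e]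
          _ = _ := by rw [hm, hm']; abel
      rw [hL, hL', hA2, hS2, e']
      calc _ = α (zLeg l') + (β (zLeg p) - β (zLeg fun _ => false))
            + (β (tLeg fun _ => false) + (γ (oneLeg s2) - γ (twoLeg s2)))
            + ((γ (oneLeg x') - γ (twoLeg x')) - (γ (oneLeg x) - γ (twoLeg x))
              + (γ (oneLeg a2) - γ (twoLeg a2)) - (γ (oneLeg s2) - γ (twoLeg s2))) := by abel
        _ = _ := by rw [key0]; abel
    have σ1 : ∀ i, cwAt (zLeg ls i) (tLeg a2 i) (kLeg ls a2 i) = true := fun i =>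
      cwAt_k (ls i) (a2 i) (by rw [hls i, ha2 i]; cases y i <;> cases l i <;> cases l' i <;> rfl)
    have σ2 : ∀ i, cwAt (zLeg ls' i) (tLeg s2 i) (kLeg ls' s2 i) = true := fun i =>
      cwAt_k (ls' i) (s2 i) (by
        rw [hls' i, hs2 i, hp i]; cases y i <;> cases l i <;> cases l' i <;> rfl)
    have u1 := (hsupp _ _ _ σ1).1; have u2 := (hsupp _ _ _ σ2).1
    have τ1 : α (zLeg ls) + β (tLeg a2) + γ (kLeg ls' s2) = u := by rw [EQ]; exact u2
    have τ2 : α (zLeg ls') + β (tLeg s2) + γ (kLeg ls a2) = u := by rw [← EQ]; exact u1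
    have hls_eq : ∀ i, ls i = ls' i := by
      rcases cwSupp_or_of_exchange α β γ u ω₁ ω₂ ω₃ h hsupp hcut (zLeg ls) (tLeg a2) (kLeg ls a2)
          (zLeg ls') (tLeg s2) (kLeg ls' s2) σ1 σ2 τ1 τ2 with hτ | hτ
      · exact fun i => eq_of_cwAt_swap (ls i) (a2 i) (ls' i) (s2 i) (hτ i)
      · exact fun i => (eq_of_cwAt_swap (ls' i) (s2 i) (ls i) (a2 i) (hτ i)).symm
    funext i
    have := hls_eq i; rw [hls i, hls' i, hp i] at this; revert this
    cases l i <;> cases l' i <;> cases y i <;> decide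
  -- Step B : m = m'
  subst hl
  have e2 : β (tLeg m) = β (tLeg m') := add_left_cancel e
  have d1 : ∀ i, cwAt (tLeg m i) (tLeg m i) ((fun _ => (0 : Fin 3)) i) = true :=
    fun i => cwAt_diag (m i)
  have d2 : ∀ i, cwAt (tLeg m' i) (tLeg m' i) ((fun _ => (0 : Fin 3)) i) = true :=
    fun i => cwAt_diag (m' i)
  have u1 := (hsupp _ _ _ d1).1; have u2 := (hsupp _ _ _ d2).1
  have τ1 : α (tLeg m) + β (tLeg m') + γ (fun _ => 0) = u := by rw [← e2]; exact u1
  have τ2 : α (tLeg m') + β (tLeg m) + γ (fun _ => 0) = u := by rw [e2]; exact u2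
  refine ⟨rfl, funext fun i => ?_⟩
  rcases cwSupp_or_of_exchange₂ α β γ u ω₁ ω₂ ω₃ h hsupp hcut (tLeg m) (tLeg m) (fun _ => 0)
      (tLeg m') (tLeg m') (fun _ => 0) d1 d2 τ1 τ2 with hτ | hτ
  · exact eq_of_cwAt_diag (m i) (m' i) (hτ i)
  · exact (eq_of_cwAt_diag (m' i) (m i) (hτ i)).symm

include hsupp hcut in
/-- **No-go for group degenerations in the CW basis.** If the support of `T_{cw,2}^{⊠N}` (CW basis)
is cut out of the solutions of `α a + β b + γ c = u` in a finite abelian group `H` by leg weights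
(a monomial degeneration of a restriction of the structure tensor of `ℂ[H]`), then `4 ^ N ≤ |H|`. [new] -/
theorem four_pow_le_card_of_cwDegeneration [Fintype H] : 4 ^ N ≤ Fintype.card H := by
  classical
  let Ψ : (Fin N → Bool) × (Fin N → Bool) → H := fun lm => α (zLeg lm.1) + β (tLeg lm.2)
  have inj : Function.Injective Ψ := by
    rintro ⟨l, m⟩ ⟨l', m'⟩ hΨ
    obtain ⟨h1, h2⟩ := zLeg_tLeg_injective α β γ u ω₁ ω₂ ω₃ h hsupp hcut l m l' m' hΨ
    rw [h1, h2]
  have hc := Fintype.card_le_of_injective Ψ inj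
  have h4 : (4 : ℕ) ^ N = 2 ^ N * 2 ^ N := by rw [← mul_pow]; norm_num
  rw [h4]
  simpa [Fintype.card_prod, Fintype.card_fun, Fintype.card_bool, Fintype.card_fin] using hc

omit hsupp hcut

/-- The same statement with the support written as the inline predicate of
`kroneckerPow (cwTensor ℂ 2) N` (the hypotheses of a CW-basis degeneration certificate, in the shape of
`algBorderRank_cwTwoPow_le_card_of_degeneration`): such certificates need `|H| ≥ 4^N`. [new] -/
theorem four_pow_le_card_of_cwDegeneration' [Fintype H]
    (hsupp : ∀ a b c : Fin N → Fin 3,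
      (∀ i, (a i = 0 ∧ b i = c i ∧ b i ≠ 0) ∨ (b i = 0 ∧ a i = c i ∧ a i ≠ 0) ∨
        (c i = 0 ∧ a i = b i ∧ a i ≠ 0)) → α a + β b + γ c = u ∧ ω₁ a + ω₂ b + ω₃ c = h)
    (hcut : ∀ a b c : Fin N → Fin 3, α a + β b + γ c = u →
      ¬ (∀ i, (a i = 0 ∧ b i = c i ∧ b i ≠ 0) ∨ (b i = 0 ∧ a i = c i ∧ a i ≠ 0) ∨
        (c i = 0 ∧ a i = b i ∧ a i ≠ 0)) → h < ω₁ a + ω₂ b + ω₃ c) :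
    4 ^ N ≤ Fintype.card H :=
  four_pow_le_card_of_cwDegeneration α β γ u ω₁ ω₂ ω₃ h
    (fun a b c habc => hsupp a b c fun i => (cwAt_iff _ _ _).1 (habc i))
    (fun a b c he hn => hcut a b c he fun hall => hn fun i => (cwAt_iff _ _ _).2 (hall i))

/-- **Exact realizations.** If `α a + β b + γ c = u ↔ (a, b, c) ∈ supp T_{cw,2}^{⊠N}` (CW basis) in a
finite abelian group `H` — so that `T_{cw,2}^{⊠N}` is a restriction of the structure tensor of `ℂ[H]`
and `R(T_{cw,2}^{⊠N}) ≤ |H|` — then `4 ^ N ≤ |H|`. [new] -/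
theorem four_pow_le_card_of_cwRealization [Fintype H] (α β γ : (Fin N → Fin 3) → H) (u : H)
    (hiff : ∀ a b c : Fin N → Fin 3, α a + β b + γ c = u ↔ ∀ i, cwAt (a i) (b i) (c i) = true) :
    4 ^ N ≤ Fintype.card H :=
  four_pow_le_card_of_cwDegeneration α β γ u (fun _ => 0) (fun _ => 0) (fun _ => 0) 0
    (fun a b c habc => ⟨(hiff a b c).2 habc, rfl⟩)
    (fun a b c habc hn => absurd ((hiff a b c).1 habc) hn)

end CwBasis

/-! ### Sharpness: the product realization in `(ℤ/4)^N` -/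

section Sharpness

/-- One coordinate of the `ℤ/4` realization in the CW basis: `x, y ↦ (1, 0, 2)`, `z ↦ (0, 3, 1)`. -/
theorem cwAt_iff_zmod4 (x y z : Fin 3) :
    (![(1 : ZMod 4), 0, 2] x + ![(1 : ZMod 4), 0, 2] y + ![(0 : ZMod 4), 3, 1] z = 0) ↔
      cwAt x y z = true := by
  revert x y z; decide

/-- The CW-basis support of `T_{cw,2}^{⊠N}` is realized exactly in `(ℤ/4)^N`; so `4^N` in
`four_pow_le_card_of_cwRealization` / `four_pow_le_card_of_cwDegeneration` is attained. [new] -/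
theorem cwRealization_zmod4_pow (N : ℕ) :
    ∃ (α β γ : (Fin N → Fin 3) → (Fin N → ZMod 4)) (u : Fin N → ZMod 4),
      ∀ a b c : Fin N → Fin 3, α a + β b + γ c = u ↔ ∀ i, cwAt (a i) (b i) (c i) = true := by
  refine ⟨fun a i => ![(1 : ZMod 4), 0, 2] (a i), fun b i => ![(1 : ZMod 4), 0, 2] (b i),
    fun c i => ![(0 : ZMod 4), 3, 1] (c i), 0, fun a b c => ?_⟩
  rw [funext_iff]
  exact forall_congr' fun i => by simpa using cwAt_iff_zmod4 (a i) (b i) (c i)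

end Sharpness

end Summit.MatrixMultiplication.MatrixMultiplication.Theorems
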